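import Literature.AnabelianGeometry.EtaleTheta.RootsOfUnityGaloisNontrivial
import Literature.AnabelianGeometry.EtaleTheta.TowerOfSetting
import Literature.AnabelianGeometry.EtaleTheta.SettingModelKummerDataEmpty
import HarnessLib

/-!
# The Tate-twist data `CyclotomeMod` / `CyclotomeTower` are EMPTY at the root model (NV certificate;
# proof-only)

Mochizuki, *The étale theta function …*, Publ. RIMS **45** (2009) [EtTh], §1 p. 12 "`Δ_Θ (≅ Ẑ(1))`",
Def. 2.13 p. 46 "the natural isomorphism `μ_N ≅ (l·Δ_Θ) ⊗ (ℤ/Nℤ)`" [cite: MochizukiEtTh2009, Def 2.13 p.46].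
PROOF-ONLY file of the abc-iut cell (prover abc-iut-w5-d125 gen 3; NV-L2 programme of abc-iut-L2-lead,
self-directed row «NV-L2/CyclotomeMod + CyclotomeTower at ThetaSetting.model p», STATUS 2026-08-26T05:45Z).

The D-indexed DATA `ThetaSetting.CyclotomeMod l N` (abc-iut-L2-t8, `ThetaCyclotomes.lean`) — a continuous
surjection `(l·Δ_Θ) ↠ μ_N(ℚ̄_p)` with kernel the `N`-th powers, EQUIVARIANT for conjugation by `Π^tp_X` on
`Δ_Θ` and the Galois action `galMuN` through `aug : Π^tp_X → G_{ℚ_p}` on `μ_N` — and the compatible towers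
`ThetaSetting.CyclotomeTower l E` (abc-iut-L2-t10, `TowerOfSetting.lean`; the datum of GAP-LEDGER row
G-L2t10-1 and of every [EtTh]-§2-at-the-model theorem) are the level-wise form of the Tate twist. WHAT IS
PROVED:

* `ThetaSetting.isEmpty_cyclotomeMod_of_conj_eq` — INTERFACE-LEVEL criterion: if every element of
  `Π^tp_X` centralises `Δ_Θ` (through `Π^tp_X ↠ (Π^tp_X)^Θ`) while some `g ∈ Π^tp_X` moves some
  `ζ ∈ μ_N(ℚ̄_p)` through `aug`, then `D.CyclotomeMod l N` is EMPTY (equivariance `red_conj` would force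
  `aug(g)` to fix the whole of `μ_N = red(l·Δ_Θ)`);
* `SettingModel.isEmpty_cyclotomeMod_model` — at abc-iut-L2-t1's root model `ThetaSetting.model p`
  (`Π^tp_X = F₂ × G_{ℚ_p}`: all of `(Π^tp_X)^Θ` centralises `Δ_Θ`, abc-iut-w5-d171's
  `toTheta_conj_eq_of_mem_deltaTheta`, p424679; `aug` is onto `G_{ℚ_p}`) `CyclotomeMod l N = ∅` for every
  `l` and every `N` with `p² ∣ N`, by the classical `exists_galMuN_apply_ne` (`RootsOfUnityGaloisNontrivial.lean`:
  `G_{ℚ_p}` moves a primitive `p²`-th root of unity — `Φ_{p²}` is irreducible over `ℚ_p`);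
* `SettingModel.isEmpty_cyclotomeTower_model` — hence `CyclotomeTower l E = ∅` at the root model for
  EVERY `l` and EVERY index set `E` (cofinality supplies a level `M ∈ E` with `p² ∣ M`);
* census forms `SettingModel.not_forall_nonempty_cyclotomeMod` / `…_cyclotomeTower`: the twist data are
  NOT derivable from `ThetaSetting + IsEtThOrigin` — GENUINE-ONLY input, exactly like `KummerData`
  (p424679) and for the same reason (untwisted `Δ_Θ`).

CONSEQUENCE (numbers for the NV register): every theorem binding `τ : D.CyclotomeTower l E` /
`μ : D.CyclotomeMod l N` (p² ∣ N) — `TowerOfSetting.thetaEnvTower`, `Sec2Cor218ivAllLevels`, the L6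
`EtaleLevels.modelSystem` / `etaleThetaDataOfSetting'` chain — quantifies over an EMPTY domain AT THE ROOT
MODEL (not in general); a χ-twisted model (L2-lead R78) is where they can be instantiated, and
`exists_galMuN_apply_ne` is the non-triviality such a model realises. Levels `N` with `μ_N ⊆ ℚ_p`
(`N ∣ p - 1`, resp. `N ∣ 2` for `p = 2`) are NOT excluded by this file. HONEST FRAMING: a statement about
the degenerate model, not about [EtTh]; nothing asserts that abc is proved or refuted; no side is taken on
[IUTchIII] Cor. 3.12; typed ≠ proved; EMPTY-at-a-toy ≠ vacuous-in-print.
-/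

noncomputable section

namespace Literature.AnabelianGeometry.EtaleTheta

open Literature.AnabelianGeometry.SemiGraphs

namespace ThetaSetting

variable {p : ℕ} [Fact p.Prime] {D : ThetaSetting p}

/-- **Interface-level emptiness criterion for the Tate-twist datum.** If `Π^tp_X` centralises `Δ_Θ`
(untwisted setting) and some `g ∈ Π^tp_X` moves some `N`-th root of unity of `ℚ̄_p` through `aug`, then
there is NO `Π^tp_X`-equivariant identification `(l·Δ_Θ) ⊗ ℤ/N ≅ μ_N`: `red_conj` gives
`galMuN (aug g) (red x) = red (g x g⁻¹) = red x` for all `x`, and `red` is onto `μ_N`.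
[cite: MochizukiEtTh2009, Def 2.13 p.46] -/
theorem isEmpty_cyclotomeMod_of_conj_eq {l : ℕ} {N : ℕ+}
    (hconj : ∀ g : D.PiTemp, ∀ a ∈ D.DeltaTheta, D.toTheta g * a * (D.toTheta g)⁻¹ = a)
    (hσ : ∃ (g : D.PiTemp) (ζ : MuN p N), galMuN p N (D.aug.toMonoidHom g) ζ ≠ ζ) :
    IsEmpty (D.CyclotomeMod l N) := by
  refine ⟨fun μ => ?_⟩
  obtain ⟨g, ζ, hne⟩ := hσ
  obtain ⟨x, rfl⟩ := μ.red_surjective ζ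
  apply hne
  rw [← μ.red_conj g x]
  congr 1
  exact Subtype.ext (hconj g x.1 (D.lDeltaTheta_le l x.2))

/-- Contrapositive packaging: a `CyclotomeMod` over an untwisted setting forces `aug(Π^tp_X)` to fix
`μ_N(ℚ̄_p)` pointwise. [cite: MochizukiEtTh2009, Def 2.13 p.46] -/
theorem CyclotomeMod.galMuN_aug_apply_eq_of_conj_eq {l : ℕ} {N : ℕ+} (μ : D.CyclotomeMod l N)
    (hconj : ∀ g : D.PiTemp, ∀ a ∈ D.DeltaTheta, D.toTheta g * a * (D.toTheta g)⁻¹ = a)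
    (g : D.PiTemp) (ζ : MuN p N) : galMuN p N (D.aug.toMonoidHom g) ζ = ζ := by
  by_contra hne
  exact (isEmpty_cyclotomeMod_of_conj_eq (l := l) hconj ⟨g, ζ, hne⟩).false μ

/-- Conversely put: a `CyclotomeMod` together with an element of `aug(Π^tp_X)` moving a root of unity
FORCES a non-trivial conjugation action of `Π^tp_X` on `Δ_Θ` (the twist). [cite: MochizukiEtTh2009, Def 2.13 p.46] -/
theorem CyclotomeMod.exists_conj_ne {l : ℕ} {N : ℕ+} (μ : D.CyclotomeMod l N)
    (hσ : ∃ (g : D.PiTemp) (ζ : MuN p N), galMuN p N (D.aug.toMonoidHom g) ζ ≠ ζ) :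
    ∃ (g : D.PiTemp) (a : D.GtpTheta), a ∈ D.DeltaTheta ∧ D.toTheta g * a * (D.toTheta g)⁻¹ ≠ a := by
  by_contra hc
  refine (isEmpty_cyclotomeMod_of_conj_eq (l := l) (N := N) (fun g a ha => ?_) hσ).false μ
  by_contra hne
  exact hc ⟨g, a, ha, hne⟩

end ThetaSetting

namespace SettingModel

open ThetaSetting

variable (p : ℕ) [hp : Fact p.Prime]

/-- In the root model `aug : Π^tp_X = F₂ × G_{ℚ_p} → G_{ℚ_p}` is the second projection: `aug (1, σ) = σ`.
[cite: MochizukiEtTh2009, §1 p.12] -/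
theorem aug_one_mk (σ : GQp p) :
    (ThetaSetting.model p).aug.toMonoidHom (((1 : Del), (σ : Gam p)) : PiTp p) = σ := rfl

/-- **NV CERTIFICATE (negative): `CyclotomeMod l N` is EMPTY at the root model whenever `p² ∣ N`** —
`(Π^tp_X)^Θ` centralises `Δ_Θ` there (abc-iut-w5-d171, `toTheta_conj_eq_of_mem_deltaTheta`), while
`G_{ℚ_p} = aug(Π^tp_X)` moves a primitive `p²`-th root of unity (`exists_galMuN_apply_ne`).
[cite: MochizukiEtTh2009, Def 2.13 p.46] -/
theorem isEmpty_cyclotomeMod_model (l : ℕ) (N : ℕ+) (hN : p ^ 2 ∣ (N : ℕ)) :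
    IsEmpty ((ThetaSetting.model p).CyclotomeMod l N) := by
  refine isEmpty_cyclotomeMod_of_conj_eq
    (fun g a ha => toTheta_conj_eq_of_mem_deltaTheta p _ a ha) ?_
  obtain ⟨σ, ζ, hne⟩ := exists_galMuN_apply_ne p N hN
  exact ⟨(((1 : Del), (σ : Gam p)) : PiTp p), ζ, by rw [aug_one_mk]; exact hne⟩

/-- **NV CERTIFICATE (negative): `CyclotomeTower l E` is EMPTY at the root model**, for every `l` and every
index set `E` (by cofinality `E` contains a multiple of `p²`). [cite: MochizukiEtTh2009, Cor 2.19 (ii) p.64] -/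
theorem isEmpty_cyclotomeTower_model (l : ℕ) (E : Set ℕ+) :
    IsEmpty ((ThetaSetting.model p).CyclotomeTower l E) := by
  refine ⟨fun τ => ?_⟩
  obtain ⟨M, hME, hM⟩ := τ.cofinal ⟨p ^ 2, pow_pos hp.out.pos 2⟩
  exact (isEmpty_cyclotomeMod_model p l M (PNat.dvd_iff.1 hM)).false (τ.mod ⟨M, hME⟩)

/-- `Nonempty` forms (census tokens «CyclotomeMod (p² ∣ N) / CyclotomeTower: 0 producers at the root
model — certified empty»). [cite: MochizukiEtTh2009, Def 2.13 p.46] -/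
theorem not_nonempty_cyclotomeMod_model (l : ℕ) (N : ℕ+) (hN : p ^ 2 ∣ (N : ℕ)) :
    ¬ Nonempty ((ThetaSetting.model p).CyclotomeMod l N) :=
  not_nonempty_iff.mpr (isEmpty_cyclotomeMod_model p l N hN)

/-- [cite: MochizukiEtTh2009, Cor 2.19 (ii) p.64] -/
theorem not_nonempty_cyclotomeTower_model (l : ℕ) (E : Set ℕ+) :
    ¬ Nonempty ((ThetaSetting.model p).CyclotomeTower l E) :=
  not_nonempty_iff.mpr (isEmpty_cyclotomeTower_model p l E)

/-- **Census form: the twist datum is NOT derivable from the root interface plus its guard** — the root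
model satisfies `IsEtThOrigin` and carries no `CyclotomeMod l N` for `p² ∣ N`.
[cite: MochizukiEtTh2009, Def 2.13 p.46] -/
theorem not_forall_nonempty_cyclotomeMod (l : ℕ) (N : ℕ+) (hN : p ^ 2 ∣ (N : ℕ)) :
    ¬ ∀ D : ThetaSetting p, D.IsEtThOrigin → Nonempty (D.CyclotomeMod l N) := fun h =>
  not_nonempty_cyclotomeMod_model p l N hN (h _ (ThetaSetting.model_isEtThOrigin p))

/-- … nor any `CyclotomeTower l E`. [cite: MochizukiEtTh2009, Cor 2.19 (ii) p.64] -/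
theorem not_forall_nonempty_cyclotomeTower (l : ℕ) (E : Set ℕ+) :
    ¬ ∀ D : ThetaSetting p, D.IsEtThOrigin → Nonempty (D.CyclotomeTower l E) := fun h =>
  not_nonempty_cyclotomeTower_model p l E (h _ (ThetaSetting.model_isEtThOrigin p))

/-- Joint statement with abc-iut-w5-d171's p424679: at the root model BOTH the Kummer data of Prop. 1.5
AND the Tate-twist data of Def. 2.13 / Cor. 2.19 (ii) are absent — one witness `D` for the independence of
both from `ThetaSetting + IsEtThOrigin`. [cite: MochizukiEtTh2009, §1 p.12] -/
theorem exists_isEtThOrigin_isEmpty_twistData (l : ℕ) (E : Set ℕ+) :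
    ∃ D : ThetaSetting p, D.IsEtThOrigin ∧ IsEmpty D.KummerData ∧ IsEmpty (D.CyclotomeTower l E) :=
  ⟨ThetaSetting.model p, ThetaSetting.model_isEtThOrigin p, ThetaSetting.model_isEmpty_kummerData p,
    isEmpty_cyclotomeTower_model p l E⟩

end SettingModel

end Literature.AnabelianGeometry.EtaleTheta

end
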